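import Summits.QuantumFields.BalabanUV.T4Continuum.Support.BalabanHardMinimizerGauge
import Literature.MathematicalPhysics.QuantumFieldTheory.Balaban1983to89.B5Hk163Form166

/-!
# T⁴ programme, spine node NE2 (U1a) — IDENTIFICATION WITH THE TREE's TYPED (1.65)/(1.95)/(1.103) OBJECTS, and
# the η-RATE OF BAŁABAN's EFFECTIVE ACTIONS `Δ_k` (1.65) AT `U = 1`, UNCONDITIONAL

Eighth generation of the NE2 prover lineage P1 of the cell `pub-balaban`, file 18 — and an ERRATUM to the headers of files 14
(`Support/BalabanHardMinimizer`), 16 (`…HardMinimizerGauge`) and 17 (`…Gauge195Fibre`).  Those headers say that the printed gauge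
identity [Balaban1984PropagatorsI] (1.95) «R∂*GQ* = 0» for the concrete lattice operators, and the dictionary `Δ_k = (QGQ*)⁻¹ − a`,
are "not in the tree".  THAT IS WRONG: the β cell's modules hold them, kernel-checked —
`Beta.LandauMultiplierIdentities.R_div_G_QvAdj_eq_zero : (1 − PcT)·GradOpᴴ·calG·QvAdj = 0` ((1.95), CONCRETE),
`Beta.FluctuationProjection.Hk := calG·QvAdj·(QGQ)⁻¹` ((1.103) «H_k = GQ*(QGQ*)⁻¹») with `QvOp_mul_Hk`, `R_div_Hk`,
`Beta.BlockEffectiveAction.DelK := n^{−d}·Hkᴴ(½CurlᴴCurl)Hk` ((1.65)) with `DelK_eq : DelK = (QGQ)⁻¹ − a•1`, `DelK_posSemidef`,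
`DelK_mulVec_const`, and b05's `B5Hk163Form166.HkOp_eq_Hk` (the (1.63) operator = the (1.103) operator).  The seat had searched
`B5HkProperties` (abstract operator data) and the cross-read record, not the β cell's `Beta/` directory.  Files 14/16/17 remain correct
as mathematics (an independent route: hard completing-the-square, curl splitting, the fibrewise (1.95)); their residual
(R9.xii′)/(R9.xii″) does NOT exist.  THIS FILE makes the identification explicit and draws the consequence that matters for NE2:

* §1 `covB_eq_QGQ` (`B5QGQ171Unit.covB = Beta.FluctuationProjection.QGQ`), **`DeltaK_eq_DelK`** (file 14's `Δ_K = covB⁻¹ − a•1` IS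
  the β cell's typed (1.65) operator `DelK`, by `DelK_eq`), **`gauge195_holds : Gauge195 n hn M a ha`** (file 16's typed input
  DISCHARGED by `R_div_G_QvAdj_eq_zero`), `Hk_eq_betaHk_mulVec` / `Hk_eq_HkOp_mulVec` (file 14's `Hk B` = `Beta….Hk *ᵥ B` =
  `B5Hk163Torus.HkOp *ᵥ B`, the (1.63) minimiser).
* §2 file 16's conditional theorems made UNCONDITIONAL: `form_DeltaK_eq_curl` ((1.65) «⟨B, Δ_kB⟩ = ⟨∂H_kB, ∂H_kB⟩» for `Δ_K`),
  `hk_props` (the three printed properties of `H_kB`, p. 29).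
* §3 **THE η-RATE OF (1.65) AT `U = 1`** (`L ≥ 2`, every torus `M`, every `a > 0`): along the levels `n_k = L^k`, the tree's typed
  effective-action operators `DelKlev k := Beta.BlockEffectiveAction.DelK (L^k) …` CONVERGE in operator norm with
  `‖Δ_k^{(L^k)} − Δ_∞‖ ≤ γ(d,a)⁻²·CQB(d,a)·L^{−k}/(1 − L^{−1})`, `γ(d,a) = ((dπ² + a)(π²/4)^{d+1})⁻¹` — **`DelKlev_tendsto`** (=
  file 14's `DeltaKlev_tendsto` transported along `DeltaK_eq_DelK`).  This is the T4-DAG object X8 («Δ_k», (1.65)) of node U1a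
  at `U = 1`, with a geometric η-rate and explicit constants: the statement the NE2 row asks for, on the `U = 1` layer.

HONEST FRAMING (T4-DAG p. 1).  [folklore] bookkeeping between kernel objects of the cell (`Summits/…/Support`) and of the
β cell / b05 (`Literature/…/Beta`, `B5Hk163Form166`) plus one `Tendsto` transport; statements OURS; nothing printed is a hypothesis;
the rate and constants are ours (Bałaban prints no η-rate; King's (4.18)/(4.38) is the scalar template).  `U = 1`, FIXED FINITE
torus, linear layer; NOT `U ≠ 1` (WALL G-an2-4), NOT infinite volume, NOT a mass gap, NOT Clay, NOT summit progress; spine 0/9.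
HONEST DEPENDENCY: continuum YM on T⁴ ⇐ BetaPertH ∧ nine spine estimates (0/9 proved); BetaPertH ⇐ (D1) ∧ (D4) ∧ CAP+tail;
G-an2-4 gates asym, D1 and NE2/3/4.  ABSOLUTE RULE kept; no `sorry`.
-/

noncomputable section

open scoped BigOperators ComplexConjugate Matrix ComplexOrder Matrix.Norms.L2Operator Topology
open Filter

namespace Summit.QuantumFields.BalabanUV.T4Continuum.BalabanDeltaKIdentification

open Literature.MathematicalPhysics.QuantumFieldTheory.Balaban1983to89.B5Prop11Plancherel
open Literature.MathematicalPhysics.QuantumFieldTheory.Balaban1983to89.B5Prop11Inverse (calDa)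
open Literature.MathematicalPhysics.QuantumFieldTheory.Balaban1983to89.B5Block118 (QvOp)
open Literature.MathematicalPhysics.QuantumFieldTheory.Balaban1983to89.B5QGQ171Unit (covB)
open Literature.MathematicalPhysics.QuantumFieldTheory.Balaban1983to89.B5DeltaA169 (QvAdj QvAdj_mulVec)
open Literature.MathematicalPhysics.QuantumFieldTheory.Balaban1983to89.B5Action121 (GradOp CurlOp)
open Literature.MathematicalPhysics.QuantumFieldTheory.Balaban1983to89.B5Value126 (PcT)
open Literature.MathematicalPhysics.QuantumFieldTheory.Balaban1983to89.B5G183RateUnitTower (lev lev_neZero)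
open Literature.MathematicalPhysics.QuantumFieldTheory.Balaban1983to89.B5Hk163Torus (HkOp)
open Literature.MathematicalPhysics.QuantumFieldTheory.Balaban1983to89.B5Hk163Form166 (HkOp_eq_Hk)
open Literature.MathematicalPhysics.QuantumFieldTheory.Balaban1983to89.Beta
open Summit.QuantumFields.BalabanUV.T4Continuum.BalabanLineAverage (CQB)
open Summit.QuantumFields.BalabanUV.T4Continuum.BalabanAveragedTowerUnit (one_le_lev')
open Summit.QuantumFields.BalabanUV.T4Continuum.BalabanAveragedCoercive (gammaB)
open Summit.QuantumFields.BalabanUV.T4Continuum.BalabanHardMinimizer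
open Summit.QuantumFields.BalabanUV.T4Continuum.BalabanHardMinimizerGauge

variable {d : ℕ}

/-! ## §1 The identifications -/

section Ident

variable (n : ℕ) [NeZero n] (hn : 1 ≤ n) (M : Fin d → ℕ) [hM : ∀ μ, NeZero (M μ)] (a : ℝ) (ha : 0 < a)

/-- b05's averaged propagator `covB = n^d·Q_k𝒢Q_kᴴ` IS the β cell's `QGQ = Q_k·𝒢·Q_k^*`. [folklore] -/
theorem covB_eq_QGQ : covB n hn M a ha = FluctuationProjection.QGQ n hn M a ha := by
  rw [FluctuationProjection.QGQ_eq_smul, covB]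

/-- **file 14's `Δ_K = covB⁻¹ − a•1` IS the tree's typed (1.65) operator `Δ_k`** (`Beta.BlockEffectiveAction.DelK`, by its
`DelK_eq : Δ_k = (QGQ*)⁻¹ − a·1`). [cite: Balaban1984PropagatorsI, (1.65) p.29, (1.103) p.34] -/
theorem DeltaK_eq_DelK : DeltaK n hn M a ha = BlockEffectiveAction.DelK n hn M a ha := by
  rw [BlockEffectiveAction.DelK_eq, DeltaK, covB_eq_QGQ]

/-- **file 16's typed input `Gauge195` HOLDS**: it is the β cell's concrete (1.95) `R_div_G_QvAdj_eq_zero` divided by `n^d`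
(`Q* = n^d·Q_kᴴ`). [cite: Balaban1984PropagatorsI, (1.95) p.33] -/
theorem gauge195_holds : Gauge195 n hn M a ha := by
  have h := LandauMultiplierIdentities.R_div_G_QvAdj_eq_zero n hn M a ha
  rw [QvAdj, Matrix.mul_smul] at h
  exact (smul_eq_zero.mp h).resolve_left (pow_ne_zero _ (Nat.cast_ne_zero.mpr (NeZero.ne n)))

/-- file 14's hard minimiser IS the β cell's (1.103) `H_k = GQ*(QGQ*)⁻¹`. [cite: Balaban1984PropagatorsI, (1.103) p.34] -/
theorem Hk_eq_betaHk_mulVec (B : Tor M × Fin d → ℂ) :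
    BalabanHardMinimizer.Hk n hn M a ha B = FluctuationProjection.Hk n hn M a ha *ᵥ B := by
  rw [BalabanHardMinimizer.Hk, cinv, FluctuationProjection.Hk, ← Matrix.mulVec_mulVec, ← Matrix.mulVec_mulVec,
    QvAdj_mulVec, covB_eq_QGQ, Matrix.smul_mulVec, Matrix.mulVec_smul]

/-- … and IS b05's (1.63) operator `H_k` (`B5Hk163Torus.HkOp`, via `B5Hk163Form166.HkOp_eq_Hk`).
[cite: Balaban1984PropagatorsI, (1.63) p.28, (1.103) p.34] -/
theorem Hk_eq_HkOp_mulVec (B : Tor M × Fin d → ℂ) : BalabanHardMinimizer.Hk n hn M a ha B = HkOp n M *ᵥ B := by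
  rw [Hk_eq_betaHk_mulVec, ← HkOp_eq_Hk n hn M a ha]

/-! ## §2 File 16's conclusions, unconditional -/

/-- **(1.65) for `Δ_K`, UNCONDITIONAL**: `n^d·⟨B, Δ_K B⟩ = ½⟨Curl HB, Curl HB⟩` = `η^{−d}·⟨∂H_kB, ∂H_kB⟩`.
[cite: Balaban1984PropagatorsI, (1.65) p.29, (1.21) p.21 (statement); proof ours] -/
theorem form_DeltaK_eq_curl (B : Tor M × Fin d → ℂ) :
    ((n : ℂ) ^ d) * (star B ⬝ᵥ (DeltaK n hn M a ha *ᵥ B))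
      = (1 / 2 : ℂ) * (star (CurlOp (fine n M) (n : ℂ) *ᵥ BalabanHardMinimizer.Hk n hn M a ha B)
          ⬝ᵥ (CurlOp (fine n M) (n : ℂ) *ᵥ BalabanHardMinimizer.Hk n hn M a ha B)) :=
  form_DeltaK_eq_curl_of_gauge195 n hn M a ha (gauge195_holds n hn M a ha) B

/-- the three printed properties of `H_kB` (p. 29) + (1.65), UNCONDITIONAL, for file 14's `H` (= the tree's `H_k`). [cite:
Balaban1984PropagatorsI, p.29, (1.65) (statements); proofs ours] -/
theorem hk_props (B : Tor M × Fin d → ℂ) :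
    QvOp n M *ᵥ BalabanHardMinimizer.Hk n hn M a ha B = B ∧
      (1 - PcT n M (n : ℂ)) *ᵥ ((GradOp (fine n M) (n : ℂ))ᴴ *ᵥ BalabanHardMinimizer.Hk n hn M a ha B) = 0 ∧
      (∀ A : Tor (fine n M) × Fin d → ℂ, QvOp n M *ᵥ A = B →
        (1 - PcT n M (n : ℂ)) *ᵥ ((GradOp (fine n M) (n : ℂ))ᴴ *ᵥ A) = 0 →
          ((1 / 2 : ℂ) * (star (CurlOp (fine n M) (n : ℂ) *ᵥ BalabanHardMinimizer.Hk n hn M a ha B)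
              ⬝ᵥ (CurlOp (fine n M) (n : ℂ) *ᵥ BalabanHardMinimizer.Hk n hn M a ha B))).re
            ≤ ((1 / 2 : ℂ) * (star (CurlOp (fine n M) (n : ℂ) *ᵥ A) ⬝ᵥ (CurlOp (fine n M) (n : ℂ) *ᵥ A))).re) ∧
      ((n : ℂ) ^ d) * (star B ⬝ᵥ (DeltaK n hn M a ha *ᵥ B))
        = (1 / 2 : ℂ) * (star (CurlOp (fine n M) (n : ℂ) *ᵥ BalabanHardMinimizer.Hk n hn M a ha B)
            ⬝ᵥ (CurlOp (fine n M) (n : ℂ) *ᵥ BalabanHardMinimizer.Hk n hn M a ha B)) :=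
  hk_props_of_gauge195 n hn M a ha (gauge195_holds n hn M a ha) B

end Ident

/-! ## §3 The η-rate of Bałaban's effective actions `Δ_k` (1.65) at `U = 1` -/

section Tower

variable (L : ℕ) [NeZero L] (M : Fin d → ℕ) [hM : ∀ μ, NeZero (M μ)] (a : ℝ) (ha : 0 < a)

/-- the tree's typed (1.65) operators along the levels `n_k = L^k`, on the fixed carrier `Tor M × Fin d`.
[cite: Balaban1984PropagatorsI, (1.65) p.29] -/
def DelKlev (k : ℕ) : Matrix (Tor M × Fin d) (Tor M × Fin d) ℂ :=
  BlockEffectiveAction.DelK (lev L k) (one_le_lev' L k) M a ha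

/-- `DelKlev k = DeltaKlev k` (file 14's tower). [folklore] -/
theorem DelKlev_eq_DeltaKlev (k : ℕ) : DelKlev L M a ha k = DeltaKlev L M a ha k := by
  rw [DelKlev, DeltaKlev_eq, DeltaK_eq_DelK]

/-- **THE η-RATE OF (1.65) AT `U = 1`, UNCONDITIONAL** (`L ≥ 2`; every torus `M`, every `a > 0`, every `d`): the typed effective
actions `Δ_k` of the `k`-fold averaged free vector field ((1.18) averaging, Landau-type gauge structure of (1.69)/(1.70)) at levels
`L^k` CONVERGE in operator norm, `‖Δ^{(L^k)} − Δ_∞‖ ≤ γ(d,a)⁻²·CQB(d,a)·L^{−k}/(1 − L^{−1})`.  The rate and constants are ours;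
Bałaban prints none. [cite: Balaban1984PropagatorsI, (1.65) p.29 (object); King1986, Lemma 4.3 (4.18) p.672 (scalar template)]
[folklore] -/
theorem DelKlev_tendsto (hL : 2 ≤ L) :
    ∃ Dinf : Matrix (Tor M × Fin d) (Tor M × Fin d) ℂ,
      Tendsto (DelKlev L M a ha) atTop (𝓝 Dinf) ∧
      ∀ k, ‖DelKlev L M a ha k - Dinf‖ ≤ ((gammaB d a)⁻¹) ^ 2 * (CQB d a * ((L : ℝ)⁻¹) ^ k / (1 - (L : ℝ)⁻¹)) := by
  have e : DelKlev L M a ha = DeltaKlev L M a ha := funext fun k => DelKlev_eq_DeltaKlev L M a ha k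
  rw [e]
  exact DeltaKlev_tendsto L M a ha hL

end Tower

end Summit.QuantumFields.BalabanUV.T4Continuum.BalabanDeltaKIdentification

end
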